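import Mathlib
import HarnessLib
import Literature.NumberTheory.Sieve.BatemanHorn
import Literature.NumberTheory.Sieve.BatemanHornProofs
import Literature.NumberTheory.LFunctions.MertensElementary
import Literature.NumberTheory.LFunctions.MertensTail

/-!
# Lemmas for the Euler-product bounds of S4 (stub `stub_mertensOmega` and shared local-factor lemmas)

Line `smooth-rough-lattice-acquisition` of crux stmt-Parity-11291
(`Summit.Parity.BatemanHorn.Theses.AlmostPrimeZeros.SystemZeroRepulsion`), stub S4, Stage B, part 1:
* the two-sided Mertens estimate `|Σ_{P < p ≤ Y} ω_f(p)/p − k (log log Y − log log P)| ≤ K(f)`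
  (`stub_mertensOmega`; tree Mertens bounds + bounded partial sums of `Σ_p (k − ω_f(p))/p`,
  `AZFG2020_tendsto_sum_sub_omega_div_holds`);
* elementary analytic lemmas (`‖1 + w‖ ≤ e^{Re w + ‖w‖²/2}`, products versus exponentials of sums,
  `Σ_{p > P} 1/p² ≤ 2/P`, `∏_{n ≤ u} K u²/n² ≤ e^{(log K + 4)u}` by Stirling);
* the local factors `E_p(w) = Σ_{b < p²} w^{e(b)}` of a pattern `e : ℕ → ℕ`: trivial bound
  `E_p(t)/p² ≤ max(1,t)^{2k}` when `e ≤ 2k`, and the good-prime evaluation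
  `E_p(w) = p² + ω (w − 1)(p + w)` from the counts `#{e = 1} = (p−1)ω`, `#{e = 2} = ω`, `e ≤ 2`.
These are imported by the (Λ) and (B) files (`…EulerBoundComplex`, `…EulerBoundReal`).
-/

noncomputable section

namespace Summit.Parity.BatemanHorn.Cruxes.SystemZeroRepulsion.SmoothRoughLatticeAcquisition

open Finset Literature.NumberTheory.Sieve

/-! ### Elementary analytic lemmas -/

/-- `‖1 + w‖ ≤ exp(Re w + ‖w‖²/2)` (from `‖1 + w‖² = 1 + 2 Re w + ‖w‖² ≤ e^{2 Re w + ‖w‖²}`). -/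
theorem norm_one_add_le_exp (w : ℂ) : ‖1 + w‖ ≤ Real.exp (w.re + ‖w‖ ^ 2 / 2) := by
  have h1 : ‖1 + w‖ ^ 2 = 1 + 2 * w.re + ‖w‖ ^ 2 := by
    rw [Complex.sq_norm, Complex.sq_norm, Complex.normSq_add]
    simp [Complex.normSq_one]
    ring
  have h2 : ‖1 + w‖ ^ 2 ≤ Real.exp (w.re + ‖w‖ ^ 2 / 2) ^ 2 := by
    rw [h1, ← Real.exp_nat_mul, show ((2 : ℕ) : ℝ) * (w.re + ‖w‖ ^ 2 / 2) = 2 * w.re + ‖w‖ ^ 2 by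
      push_cast; ring]
    linarith [Real.add_one_le_exp (2 * w.re + ‖w‖ ^ 2)]
  exact (pow_le_pow_iff_left₀ (norm_nonneg _) (Real.exp_pos _).le two_ne_zero).1 h2

/-- If `0 ≤ g ≤ exp ∘ h` on `s` then `∏_s g ≤ exp(Σ_s h)`. -/
theorem prod_le_exp_sum {ι : Type*} (s : Finset ι) {g h : ι → ℝ} (h0 : ∀ i ∈ s, 0 ≤ g i)
    (hle : ∀ i ∈ s, g i ≤ Real.exp (h i)) : ∏ i ∈ s, g i ≤ Real.exp (∑ i ∈ s, h i) := by
  rw [Real.exp_sum]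
  exact prod_le_prod h0 hle

/-- If `0 ≤ g ≤ B` on `s` then `∏_s g ≤ B^{#s}`. -/
theorem prod_le_pow_card_of_le {ι : Type*} (s : Finset ι) {g : ι → ℝ} {B : ℝ}
    (h0 : ∀ i ∈ s, 0 ≤ g i) (hle : ∀ i ∈ s, g i ≤ B) : ∏ i ∈ s, g i ≤ B ^ #s := by
  rw [← prod_const]
  exact prod_le_prod h0 hle

/-- `Σ_{p ∈ S, P < p} 1/p² ≤ 2/P` for a set `S` of naturals `≤ N` and real `P > 0`. -/
theorem sum_inv_sq_filter_le {S : Finset ℕ} {N : ℕ} (hS : ∀ p ∈ S, p ≤ N) {P : ℝ}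
    (hP : 0 < P) : ∑ p ∈ S.filter (fun p : ℕ => P < (p : ℝ)), 1 / (p : ℝ) ^ 2 ≤ 2 / P := by
  have hsub : S.filter (fun p : ℕ => P < (p : ℝ)) ⊆ Ioo ⌊P⌋₊ (N + 1) := by
    intro p hp
    rw [mem_filter] at hp
    rw [mem_Ioo]
    exact ⟨(Nat.floor_lt hP.le).2 hp.2, Nat.lt_succ_of_le (hS p hp.1)⟩
  calc ∑ p ∈ S.filter (fun p : ℕ => P < (p : ℝ)), 1 / (p : ℝ) ^ 2
      ≤ ∑ p ∈ Ioo ⌊P⌋₊ (N + 1), 1 / (p : ℝ) ^ 2 :=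
        sum_le_sum_of_subset_of_nonneg hsub fun p _ _ => by positivity
    _ = ∑ p ∈ Ioo ⌊P⌋₊ (N + 1), ((p : ℝ) ^ 2)⁻¹ := by simp_rw [one_div]
    _ ≤ 2 / ((⌊P⌋₊ : ℝ) + 1) := sum_Ioo_inv_sq_le _ _
    _ ≤ 2 / P := div_le_div_of_nonneg_left (by norm_num) hP (Nat.lt_floor_add_one P).le

/-- `Σ_{n ≤ u} log⁺` bookkeeping: for `K ≥ 1`, `u ≥ 2` and `s ⊆ {1, …, ⌊u⌋}`,
`∏_{n ∈ s} K u²/n² ≤ exp((log K + 4) u)` (Stirling: `log N! ≥ N log N − N`). -/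
theorem prod_mul_sq_div_sq_le {s : Finset ℕ} {u K : ℝ} (hu : 2 ≤ u) (hK : 1 ≤ K)
    (hs : ∀ n ∈ s, 1 ≤ n ∧ (n : ℝ) ≤ u) :
    ∏ n ∈ s, K * u ^ 2 / (n : ℝ) ^ 2 ≤ Real.exp ((Real.log K + 4) * u) := by
  set N : ℕ := ⌊u⌋₊ with hN
  have hu0 : 0 < u := by linarith
  have hN1 : 1 ≤ N := Nat.le_floor (by norm_num; linarith)
  have hNu : (N : ℝ) ≤ u := Nat.floor_le hu0.le
  have huN : u ≤ 2 * N := by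
    have h1 := Nat.lt_floor_add_one u
    have h2 : (1 : ℝ) ≤ N := by exact_mod_cast hN1
    rw [← hN] at h1
    linarith
  have hsub : s ⊆ Icc 1 N := fun n hn => mem_Icc.2 ⟨(hs n hn).1, Nat.le_floor (hs n hn).2⟩
  have hfac : ∀ n ∈ Icc 1 N, 1 ≤ K * u ^ 2 / (n : ℝ) ^ 2 := by
    intro n hn
    rw [mem_Icc] at hn
    have hn0 : (0 : ℝ) < n := by exact_mod_cast hn.1
    have hnu : (n : ℝ) ≤ u := le_trans (by exact_mod_cast hn.2) hNu
    rw [le_div_iff₀ (by positivity), one_mul]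
    calc (n : ℝ) ^ 2 ≤ u ^ 2 := pow_le_pow_left₀ hn0.le hnu 2
      _ ≤ K * u ^ 2 := le_mul_of_one_le_left (by positivity) hK
  -- extend the product to `{1, …, N}`
  have hext : ∏ n ∈ s, K * u ^ 2 / (n : ℝ) ^ 2 ≤ ∏ n ∈ Icc 1 N, K * u ^ 2 / (n : ℝ) ^ 2 := by
    rw [← prod_sdiff hsub]
    refine le_mul_of_one_le_left (prod_nonneg fun n hn => zero_le_one.trans (hfac n (hsub hn))) ?_
    calc (1 : ℝ) = ∏ _n ∈ Icc 1 N \ s, (1 : ℝ) := prod_const_one.symm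
      _ ≤ _ := prod_le_prod (fun _ _ => zero_le_one) fun n hn => hfac n (sdiff_subset hn)
  refine hext.trans ?_
  -- evaluate: `∏_{n ≤ N} K u²/n² = K^N u^{2N}/(N!)²`, and take logarithms
  have hfacR : ∏ n ∈ Icc 1 N, (n : ℝ) = (N.factorial : ℝ) := by
    rw [← Finset.Ico_add_one_right_eq_Icc, ← Finset.prod_Ico_id_eq_factorial, Nat.cast_prod]
  have hprod : ∏ n ∈ Icc 1 N, K * u ^ 2 / (n : ℝ) ^ 2 =
      K ^ N * u ^ (2 * N) / ((N.factorial : ℝ)) ^ 2 := by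
    rw [prod_div_distrib, prod_const, Nat.card_Icc, Nat.add_sub_cancel, mul_pow, ← pow_mul,
      prod_pow, hfacR]
  rw [hprod]
  have hfpos : (0 : ℝ) < N.factorial := by exact_mod_cast N.factorial_pos
  have hlogfac := Literature.NumberTheory.LFunctions.MertensBound.mul_log_sub_le_log_factorial N
  have hK0 : 0 < K := by linarith
  rw [← Real.exp_log (show 0 < K ^ N * u ^ (2 * N) / (N.factorial : ℝ) ^ 2 by positivity),
    Real.exp_le_exp, Real.log_div (by positivity) (by positivity), Real.log_mul (by positivity)
    (by positivity), Real.log_pow, Real.log_pow, Real.log_pow]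
  -- `N log K + 2N log u − 2 log N! ≤ N log K + 2N (log u − log N) + 2N ≤ (log K + 4) u`
  have hlogK : 0 ≤ Real.log K := Real.log_nonneg hK
  have hNpos : (0 : ℝ) < N := by exact_mod_cast hN1
  have hluN : Real.log u - Real.log N ≤ 1 := by
    rw [← Real.log_div hu0.ne' hNpos.ne']
    have : u / N ≤ 2 := by rw [div_le_iff₀ hNpos]; linarith
    calc Real.log (u / N) ≤ Real.log 2 := Real.log_le_log (by positivity) this
      _ ≤ 1 := by linarith [Real.log_two_lt_d9]
  push_cast
  nlinarith [mul_le_mul_of_nonneg_left hNu hlogK, mul_le_mul_of_nonneg_left hluN hNpos.le]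

/-! ### Two-sided Mertens estimate for `Σ ω_f(p)/p` -/

/-- **`stub_mertensOmega`** (two-sided Mertens estimate along the system): for a Bateman–Horn system
there is `K = K(f) ≥ 0` with `|Σ_{P < p ≤ Y} ω_f(p)/p − k (log log Y − log log P)| ≤ K` whenever
`3 ≤ P ≤ Y` (tree: two-sided Mertens for `Σ 1/p`, and bounded partial sums of the convergent series
`Σ_p (k − ω_f(p))/p`, `AZFG2020_tendsto_sum_sub_omega_div_holds`). -/
theorem stub_mertensOmega :
    ∀ (k : ℕ) (f : Fin k → Polynomial ℤ), Literature.NumberTheory.Sieve.IsBatemanHornSystem f →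
      ∃ K : ℝ, 0 ≤ K ∧ ∀ P Y : ℝ, 3 ≤ P → P ≤ Y →
        |(∑ p ∈ (Nat.primesLE ⌊Y⌋₊).filter (fun p : ℕ => P < (p : ℝ)),
            (Literature.NumberTheory.Sieve.polyRootCountMod f p : ℝ) / (p : ℝ)) -
          (k : ℝ) * (Real.log (Real.log Y) - Real.log (Real.log P))| ≤ K := by
  intro k f hf
  obtain ⟨Lim, hT⟩ := AZFG2020_tendsto_sum_sub_omega_div_holds k f hf
  set T : ℕ → ℝ := fun x => ∑ p ∈ Nat.primesLE x, ((k : ℝ) - polyRootCountMod f p) / p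
    with hT_def
  obtain ⟨M, hM⟩ := (Metric.isBounded_range_of_tendsto T hT).exists_norm_le
  have hMx : ∀ x, |T x| ≤ M := fun x => by
    simpa [Real.norm_eq_abs] using hM (T x) ⟨x, rfl⟩
  have hM0 : 0 ≤ M := (abs_nonneg _).trans (hMx 0)
  refine ⟨14 * k + 2 * M, by positivity, fun P Y hP hPY => ?_⟩
  set a : ℕ := ⌊P⌋₊ with ha
  set b : ℕ := ⌊Y⌋₊ with hb
  have hY0 : 0 ≤ Y := by linarith
  have ha3 : 3 ≤ a := Nat.le_floor (by norm_num; linarith)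
  have hab : a ≤ b := Nat.floor_le_floor hPY
  have hmono : Nat.primesLE a ⊆ Nat.primesLE b := fun p hp =>
    Nat.mem_primesLE.2 ⟨(Nat.mem_primesLE.1 hp).1.trans hab, (Nat.mem_primesLE.1 hp).2⟩
  set F := (Nat.primesLE b).filter (fun p : ℕ => P < (p : ℝ)) with hF
  have hFsdiff : F = Nat.primesLE b \ Nat.primesLE a := by
    ext p
    simp only [hF, mem_filter, mem_sdiff, Nat.mem_primesLE]
    constructor
    · rintro ⟨⟨hpb, hp⟩, hPp⟩
      exact ⟨⟨hpb, hp⟩, fun h => (not_le.2 hPp) ((Nat.le_floor_iff' hp.ne_zero).1 h.1)⟩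
    · rintro ⟨⟨hpb, hp⟩, hna⟩
      refine ⟨⟨hpb, hp⟩, (Nat.floor_lt' hp.ne_zero).1 (not_le.1 fun h => hna ⟨h, hp⟩)⟩
  have hFIoc : F = (Ioc ⌊P⌋₊ ⌊Y⌋₊).filter Nat.Prime := by
    ext p
    simp only [hF, mem_filter, mem_Ioc, Nat.mem_primesLE]
    constructor
    · rintro ⟨⟨hpb, hp⟩, hPp⟩
      exact ⟨⟨(Nat.floor_lt' hp.ne_zero).2 hPp, hpb⟩, hp⟩
    · rintro ⟨⟨hap, hpb⟩, hp⟩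
      exact ⟨⟨hpb, hp⟩, (Nat.floor_lt' hp.ne_zero).1 hap⟩
  -- (i) the `(k − ω)` part is a difference of two bounded partial sums
  have h1 : |∑ p ∈ F, ((k : ℝ) - polyRootCountMod f p) / p| ≤ 2 * M := by
    have e : ∑ p ∈ F, ((k : ℝ) - polyRootCountMod f p) / p = T b - T a := by
      rw [hFsdiff, eq_sub_iff_add_eq]
      exact sum_sdiff hmono
    rw [e]
    calc |T b - T a| ≤ |T b| + |T a| := abs_sub _ _
      _ ≤ M + M := add_le_add (hMx b) (hMx a)
      _ = 2 * M := by ring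
  -- (ii) lower Mertens bound
  have hlogP : 1 ≤ Real.log P :=
    (Literature.NumberTheory.LFunctions.MertensBound.one_lt_log_three).le.trans
      (Real.log_le_log (by norm_num) hP)
  have h2 : Real.log (Real.log Y) - Real.log (Real.log P) - 6 ≤ ∑ p ∈ F, (1 : ℝ) / p := by
    have := Literature.NumberTheory.LFunctions.MertensBound.loglog_sub_loglog_le_sum_inv_prime
      (show (2 : ℝ) ≤ P by linarith) hPY
    rw [← hFIoc] at this
    have h6 : 6 / Real.log P ≤ 6 := by
      rw [div_le_iff₀ (by linarith)]
      linarith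
    linarith
  -- (iii) upper Mertens bound
  have h3 : ∑ p ∈ F, (1 : ℝ) / p ≤ Real.log (Real.log Y) - Real.log (Real.log P) + 14 := by
    have hb2 : 2 ≤ b := by omega
    have hup := Literature.NumberTheory.LFunctions.MertensBound.sum_inv_prime_le b hb2
    have hlow := Literature.NumberTheory.LFunctions.MertensBound.loglog_sub_loglog_le_sum_inv_prime
      (le_refl (2 : ℝ)) (show (2 : ℝ) ≤ P by linarith)
    have hsub2 : (Ioc ⌊(2 : ℝ)⌋₊ ⌊P⌋₊).filter Nat.Prime ⊆ Nat.primesLE a := by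
      intro p hp
      simp only [mem_filter, mem_Ioc] at hp
      exact Nat.mem_primesLE.2 ⟨hp.1.2, hp.2⟩
    have hlow' : Real.log (Real.log P) - Real.log (Real.log 2) - 6 / Real.log 2 ≤
        ∑ p ∈ Nat.primesLE a, (1 : ℝ) / p :=
      hlow.trans (sum_le_sum_of_subset_of_nonneg hsub2 fun p _ _ => by positivity)
    have hsplit : ∑ p ∈ F, (1 : ℝ) / p =
        ∑ p ∈ Nat.primesLE b, (1 : ℝ) / p - ∑ p ∈ Nat.primesLE a, (1 : ℝ) / p := by
      rw [hFsdiff, eq_sub_iff_add_eq]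
      exact sum_sdiff hmono
    have hbY : Real.log (Real.log b) ≤ Real.log (Real.log Y) := by
      have hb3 : (3 : ℝ) ≤ b := by exact_mod_cast ha3.trans hab
      exact Real.log_le_log (Real.log_pos (by linarith))
        (Real.log_le_log (by linarith) (Nat.floor_le hY0))
    have hl2 := Real.log_two_gt_d9
    have hnum1 : Real.log (Real.log 2) < 0 :=
      Real.log_neg (by linarith) (by linarith [Real.log_two_lt_d9])
    have hnum2 : 6 / Real.log 2 ≤ 9 := by
      rw [div_le_iff₀ (by linarith)]
      linarith
    rw [hsplit]
    linarith
  -- combine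
  have hsum : ∑ p ∈ F, (polyRootCountMod f p : ℝ) / p =
      k * ∑ p ∈ F, (1 : ℝ) / p - ∑ p ∈ F, ((k : ℝ) - polyRootCountMod f p) / p := by
    rw [mul_sum, ← sum_sub_distrib]
    refine sum_congr rfl fun p hp => ?_
    have hp0 : (p : ℝ) ≠ 0 := by
      have := (Nat.mem_primesLE.1 (mem_filter.1 hp).1).2.pos
      positivity
    field_simp
    ring
  rw [hsum]
  have hk0 : (0 : ℝ) ≤ k := Nat.cast_nonneg k
  have e : k * ∑ p ∈ F, (1 : ℝ) / p - ∑ p ∈ F, ((k : ℝ) - polyRootCountMod f p) / p -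
      k * (Real.log (Real.log Y) - Real.log (Real.log P)) =
      k * (∑ p ∈ F, (1 : ℝ) / p - (Real.log (Real.log Y) - Real.log (Real.log P))) -
        ∑ p ∈ F, ((k : ℝ) - polyRootCountMod f p) / p := by ring
  rw [e]
  calc |k * (∑ p ∈ F, (1 : ℝ) / p - (Real.log (Real.log Y) - Real.log (Real.log P))) -
        ∑ p ∈ F, ((k : ℝ) - polyRootCountMod f p) / p|
      ≤ |k * (∑ p ∈ F, (1 : ℝ) / p - (Real.log (Real.log Y) - Real.log (Real.log P)))| +
        |∑ p ∈ F, ((k : ℝ) - polyRootCountMod f p) / p| := abs_sub _ _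
    _ ≤ k * 14 + 2 * M := by
        refine add_le_add ?_ h1
        rw [abs_mul, abs_of_nonneg hk0]
        exact mul_le_mul_of_nonneg_left (abs_le.2 ⟨by linarith, by linarith⟩) hk0
    _ = 14 * k + 2 * M := by ring

/-! ### The local factors `E_p(w) = Σ_{b < p²} w^{π_p(b)}` -/

/-- `‖E_p(z)‖ ≤ E_p(‖z‖)`. -/
theorem norm_locE_le (e : ℕ → ℕ) (s : Finset ℕ) (z : ℂ) :
    ‖∑ b ∈ s, z ^ e b‖ ≤ ∑ b ∈ s, ‖z‖ ^ e b :=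
  (norm_sum_le _ _).trans (le_of_eq (sum_congr rfl fun b _ => norm_pow z (e b)))

/-- Trivial bound: `E_p(t) ≤ p² max(1,t)^{2k}` when `π_p ≤ 2k`, `t ≥ 0`. -/
theorem locE_le_trivial {k p : ℕ} (e : ℕ → ℕ) (he : ∀ b, e b ≤ 2 * k) {t : ℝ} (ht : 0 ≤ t) :
    ∑ b ∈ range (p ^ 2), t ^ e b ≤ (p : ℝ) ^ 2 * max 1 t ^ (2 * k) := by
  calc ∑ b ∈ range (p ^ 2), t ^ e b ≤ ∑ _b ∈ range (p ^ 2), max 1 t ^ (2 * k) :=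
        sum_le_sum fun b _ => (pow_le_pow_left₀ ht (le_max_right _ _) _).trans
          (pow_le_pow_right₀ (le_max_left _ _) (he b))
    _ = (p : ℝ) ^ 2 * max 1 t ^ (2 * k) := by rw [sum_const, card_range, nsmul_eq_mul]; push_cast; ring

/-- Trivial bound, normalised: `E_p(t)/p² ≤ max(1,t)^{2k}`. -/
theorem locE_div_le_trivial {k p : ℕ} (e : ℕ → ℕ) (he : ∀ b, e b ≤ 2 * k) {t : ℝ}
    (ht : 0 ≤ t) : (∑ b ∈ range (p ^ 2), t ^ e b) / (p : ℝ) ^ 2 ≤ max 1 t ^ (2 * k) := by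
  rcases Nat.eq_zero_or_pos p with rfl | hp
  · simp only [CharP.cast_eq_zero, ne_eq, OfNat.ofNat_ne_zero, not_false_eq_true, zero_pow,
      div_zero]
    positivity
  · rw [div_le_iff₀ (by positivity), mul_comm]
    exact locE_le_trivial e he ht

/-- `E_p(t) ≥ 0` for `t ≥ 0`. -/
theorem locE_nonneg (e : ℕ → ℕ) (p : ℕ) {t : ℝ} (ht : 0 ≤ t) :
    0 ≤ (∑ b ∈ range (p ^ 2), t ^ e b) / (p : ℝ) ^ 2 :=
  div_nonneg (sum_nonneg fun b _ => pow_nonneg ht _) (by positivity)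

/-- Good primes: from the counts `#{π = 1} = (p−1)ω`, `#{π = 2} = ω`, `π ≤ 2`, the local factor is the
polynomial `E_p(w) = p² + ω (w − 1)(p + w)`. -/
theorem locE_good {p ω : ℕ} (hp : 1 ≤ p) (e : ℕ → ℕ) (he : ∀ b, e b ≤ 2)
    (h1 : #((range (p ^ 2)).filter (fun b => e b = 1)) = (p - 1) * ω)
    (h2 : #((range (p ^ 2)).filter (fun b => e b = 2)) = ω) {R : Type*} [CommRing R] (w : R) :
    ∑ b ∈ range (p ^ 2), w ^ e b = (p : R) ^ 2 + ω * (w - 1) * (p + w) := by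
  classical
  have hpt : ∀ b, w ^ e b = (if e b = 0 then 1 else 0) + (if e b = 1 then 1 else 0) * w +
      (if e b = 2 then 1 else 0) * w ^ 2 := by
    intro b
    have := he b
    interval_cases e b <;> simp
  have hone : ∀ b, ((if e b = 0 then 1 else 0) + (if e b = 1 then 1 else 0) +
      (if e b = 2 then 1 else 0) : ℕ) = 1 := by
    intro b
    have := he b
    interval_cases e b <;> simp
  have hcount : #((range (p ^ 2)).filter (fun b => e b = 0)) + (p - 1) * ω + ω = p ^ 2 := by
    rw [← h1, ← h2, card_filter, card_filter, card_filter, ← sum_add_distrib, ← sum_add_distrib,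
      sum_congr rfl fun b _ => hone b, sum_const, card_range, smul_eq_mul, mul_one]
  have h0 : (#((range (p ^ 2)).filter (fun b => e b = 0)) : R) = (p : R) ^ 2 - (p - 1) * ω - ω := by
    have := congrArg (fun n : ℕ => (n : R)) hcount
    push_cast [Nat.cast_sub hp] at this
    linear_combination this
  rw [sum_congr rfl fun b _ => hpt b, sum_add_distrib, sum_add_distrib, ← sum_mul, ← sum_mul,
    sum_boole, sum_boole, sum_boole, h0, h1, h2]
  push_cast [Nat.cast_sub hp]
  ring


end Summit.Parity.BatemanHorn.Cruxes.SystemZeroRepulsion.SmoothRoughLatticeAcquisition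

end
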